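/-
Copyright (c) 2026 the pub-hodgecm-mathlib formalisation cell (harness21).  Prover seat hodgecm-mathlib-F0P3a-p04 (g30); dealer LH4-plan (g8) WORD #28 DEAL g8-#3 = (W1) under
LEAD F0P3a-plan (g15) T14-57 (M6 «NOT < XL»; GO-LIMITED (W1)+(W2)); ENGINE-CENSUS «(O4) M6» v1.1 d85d942136cb02fd §2 (E-0)∕(E-0′)∕(ROW0-of-TOT), 2026-09-02.
-/
import Literature.NumberTheory.Automorphic.UnitaryLatticeTreeOrderStability   -- ★ p845548 (F0P2-p01 g13): `map_toLin'_le_of_mem_adjoin`, `map_toLin'_le_iff_of_adjoin_eq`; brings ★ `UnitaryLatticeTreeLevelShift` (C1 `setOf_levelFixed_vertex_eq_setOf_levelShift_stable`, `map_one_add_le_iff`), ★ T1a `UnitaryLatticeTreeDefs`, ★ `UnitaryLatticeTreeTypes` (`mem_scaleLattice_iff`)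
import HarnessLib

/-!
# Self-dual lattices fixed by an ORDER: order-only dependence, the row-0 ∕ level-one SHIFT `δ ↦ ϖ⁻¹(δ − 1)`, and the shift of EISENSTEIN DATA `(Θ, a, b)` — row 0 of the
# type-(2) strata count is the TOTAL count at the shifted invariants `(n − 2, N − 1)`, for an ABSTRACT total-count function (2-free, `d`-free, any residue characteristic)

Topic `NumberTheory/Automorphic`; namespace `Literature.NumberTheory.Automorphic.UnitaryLatticeTree` (T1a currency ★ `UnitaryLatticeTreeDefs`: `[Valued K ℤᵐ⁰]`, `latt`,
`scaleLattice`, `mapGL`, `IsVertexLattice σ ϖ H d`, `IsSelfDualLattice = IsVertexLattice … 0`).  THEOREMS ONLY (no definition, no instance, no notation, no named fact,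
no `sorry`); any `N`, any valued field, NO `IsUnit 2`, NO different ∕ discriminant exponent `d` anywhere.  Cell `pub/hodgecm-mathlib` (D-0151), crux H413 =
`stmt-HodgeConjecture-24833`, line F0_P3c_DyadicPaydown (LH4), research brick (W1) = ENGINE-CENSUS «(O4) M6» FILE F1 «ORDER-ONLY + ORDER-SHIFT» (LEAD T14-57 GO-LIMITED; dealer
LH4-plan (g8) WORD #28 DEAL g8-#3).  HONEST LABEL: count-neutral; (D-UNR)∕(D-RAM) stay PRINT by D74′; `stub_N6nsDyadic` unchanged; HC_CM is proved only modulo the 7 printed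
citations (2 remaining named inputs hLiu418 = stmt-HodgeConjecture-24832, h413 = stmt-HodgeConjecture-24833) until rung 0 closes.  Nothing printed is asserted here: this is
module algebra over a valuation ring.

WHAT IS ALREADY ★ AND CITED BY NAME (not re-proved): (E-0) bare form = ★ `map_toLin'_le_iff_of_adjoin_eq` ∕ `map_toLin'_le_of_mem_adjoin` (`UnitaryLatticeTreeOrderStability`
§1; coefficient-ring-free twin ★ `OrderStability.map_le_iff_of_adjoin_eq`); (E-0′a) for `γ ∈ GL_N(K)` in the FIXED form = ★ law C1 `setOf_levelFixed_vertex_eq_setOf_levelShift_stable`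
+ ★ `map_one_add_le_iff` (`UnitaryLatticeTreeLevelShift` §5–§6).  WHAT THIS FILE ADDS: §1 the vertex-SET forms of (E-0); §2 the STABLE (not fixed, not `GL`) form of the shift law
for an arbitrary matrix `δ` and scalar `c` — `(δ−1)·M ⊆ c·M ↔ (c⁻¹(δ−1))·M ⊆ M`, `η`-stable ⇒ `δ`-stable for `δ = 1 + c·η`, the set ∕ count identities on the vertices of each type;
§3 the SHIFT OF EISENSTEIN DATA (pure algebra: if `x = φ(g, u)` for a unital `K`-algebra map `φ : M₂(K) × K → M_N(K)` — any block-diagonal frame — with `Θ = α•1 + β•g`,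
`u•1 − g = a•1 + b•Θ`, then `η = ϖ⁻¹(x − 1) = φ(g′, u′)` with `Θ = (α+β)•1 + (βϖ)•g′`, `u′•1 − g′ = (ϖ⁻¹a)•1 + (ϖ⁻¹b)•Θ`, `det(u′•1 − g′) = ϖ⁻² det(u•1 − g)`; so the invariants
`(n, N) := (ord det(u•1 − g), ord b)` drop to `(n − 2, N − 1)` and the Eisenstein generator `Θ` (`v(det Θ) = v(ϖ)`, `v(tr Θ) < 1`) is unchanged); §4 ROW 0 OF AN ABSTRACT TOTAL:
for ANY count function `F : ℕ → ℕ → ℕ` and any side condition `C` assumed at the shifted pair only (or globally shift-invariant, corollary), «TOT-Λ-shape for `F`» ⇒ «row-0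
count = `F (n−2) (N−1)`» (guards `2 ≤ n`, `1 ≤ N` = the ★ head's `hn2`∕`hN1`).  `F` is NEVER `phiTHn`: the file is visibly 2-free and `d`-free (T14-57 KILL clause).

## References
* [Jacobowitz1962] R. Jacobowitz, *Hermitian forms over local fields*, Amer. J. Math. 84 (1962), §4, §7.
* [Serre1980Trees] J.-P. Serre, *Trees* (1980), Ch. II §1.1.
* [Rogawski1990] J. D. Rogawski, *Automorphic Representations of Unitary Groups in Three Variables* (1990), §4.9 p. 55.
* [Kottwitz1986] R. E. Kottwitz, *Base change for unit elements of Hecke algebras*, Compositio Math. 60 (1986), §3.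
-/

set_option autoImplicit false

noncomputable section

open scoped Valued WithZero Matrix MatrixGroups

namespace Literature.NumberTheory.Automorphic.UnitaryLatticeTree

open Literature.NumberTheory.Automorphic

variable {K : Type*} [Field K] [Valued K ℤᵐ⁰] {N : ℕ}

/-! ## §1 (E-0) ORDER-ONLY: the `x`-stable vertices depend on `x` only through the order `𝒪[x]` -/

/-- **(E-0), SET FORM WITH A RIDING PREDICATE**: if `y ∈ 𝒪[x]` and `x ∈ 𝒪[y]` then for every predicate `P` on lattices
`{M | P M ∧ x·M ⊆ M} = {M | P M ∧ y·M ⊆ M}` (★ `map_toLin'_le_of_mem_adjoin` both ways). [cite: Kottwitz1986, §3] [cite: Serre1980Trees, Ch. II §1.1] -/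
theorem setOf_map_toLin'_le_eq_of_mem_adjoin (P : Submodule 𝒪[K] (Fin N → K) → Prop) {x y : Matrix (Fin N) (Fin N) K}
    (hy : y ∈ Algebra.adjoin 𝒪[K] ({x} : Set (Matrix (Fin N) (Fin N) K))) (hx : x ∈ Algebra.adjoin 𝒪[K] ({y} : Set (Matrix (Fin N) (Fin N) K))) :
    {M : Submodule 𝒪[K] (Fin N → K) | P M ∧ M.map ((Matrix.toLin' x).restrictScalars 𝒪[K]) ≤ M} =
      {M : Submodule 𝒪[K] (Fin N → K) | P M ∧ M.map ((Matrix.toLin' y).restrictScalars 𝒪[K]) ≤ M} := by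
  ext M
  simp only [Set.mem_setOf_eq]
  exact and_congr_right fun _ => ⟨fun h => map_toLin'_le_of_mem_adjoin M h hy, fun h => map_toLin'_le_of_mem_adjoin M h hx⟩

/-- **(E-0) ON THE VERTICES OF TYPE `d`** (`d = 0`: the self-dual lattices): `𝒪[x] = 𝒪[y]` (as mutual membership) ⇒ the `x`-stable and the `y`-stable vertices of type `d` are
the same set, hence have the same `ncard`. [cite: Jacobowitz1962, §7] [cite: Kottwitz1986, §3] -/
theorem setOf_vertex_map_toLin'_le_eq_of_mem_adjoin (σ : K →+* K) (ϖ : K) (H : Matrix (Fin N) (Fin N) K) (d : ℕ) {x y : Matrix (Fin N) (Fin N) K}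
    (hy : y ∈ Algebra.adjoin 𝒪[K] ({x} : Set (Matrix (Fin N) (Fin N) K))) (hx : x ∈ Algebra.adjoin 𝒪[K] ({y} : Set (Matrix (Fin N) (Fin N) K))) :
    {M : Submodule 𝒪[K] (Fin N → K) | IsVertexLattice σ ϖ H d M ∧ M.map ((Matrix.toLin' x).restrictScalars 𝒪[K]) ≤ M} =
      {M : Submodule 𝒪[K] (Fin N → K) | IsVertexLattice σ ϖ H d M ∧ M.map ((Matrix.toLin' y).restrictScalars 𝒪[K]) ≤ M} :=
  setOf_map_toLin'_le_eq_of_mem_adjoin _ hy hx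

/-- **(E-0), COUNT FORM on the vertices of type `d`.** [cite: Jacobowitz1962, §7] [cite: Kottwitz1986, §3] -/
theorem ncard_vertex_map_toLin'_le_eq_of_mem_adjoin (σ : K →+* K) (ϖ : K) (H : Matrix (Fin N) (Fin N) K) (d : ℕ) {x y : Matrix (Fin N) (Fin N) K}
    (hy : y ∈ Algebra.adjoin 𝒪[K] ({x} : Set (Matrix (Fin N) (Fin N) K))) (hx : x ∈ Algebra.adjoin 𝒪[K] ({y} : Set (Matrix (Fin N) (Fin N) K))) :
    {M : Submodule 𝒪[K] (Fin N → K) | IsVertexLattice σ ϖ H d M ∧ M.map ((Matrix.toLin' x).restrictScalars 𝒪[K]) ≤ M}.ncard =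
      {M : Submodule 𝒪[K] (Fin N → K) | IsVertexLattice σ ϖ H d M ∧ M.map ((Matrix.toLin' y).restrictScalars 𝒪[K]) ≤ M}.ncard := by
  rw [setOf_vertex_map_toLin'_le_eq_of_mem_adjoin σ ϖ H d hy hx]

/-! ## §2 (E-0′a) THE SHIFT `η = c⁻¹(δ − 1)`: `(δ − 1)·M ⊆ c·M ↔ η·M ⊆ M`, for ANY matrix `δ` and ANY lattice `M` (stable form; no `GL`, no basis) -/

/-- **LEVEL `c` ↔ SHIFT-STABLE**, for any `𝒪`-submodule `M ⊆ K^N`, any matrix `δ` and any `c ≠ 0`: `(δ − 1)·M ⊆ c·M ↔ (c⁻¹ • (δ − 1))·M ⊆ M`.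
(★ `map_sub_one_latt_le_scaleLattice_iff` ∕ `map_levelShift_latt_le_iff` are the `M = latt g`, `δ ∈ GL` readings in a basis.) [cite: Kottwitz1986, §3] [cite: Serre1980Trees, Ch. II §1.1] -/
theorem map_sub_one_le_scaleLattice_iff_map_shift_le {c : K} (hc : c ≠ 0) (δ : Matrix (Fin N) (Fin N) K) (M : Submodule 𝒪[K] (Fin N → K)) :
    M.map ((Matrix.toLin' (δ - 1)).restrictScalars 𝒪[K]) ≤ scaleLattice c M ↔ M.map ((Matrix.toLin' (c⁻¹ • (δ - 1))).restrictScalars 𝒪[K]) ≤ M := by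
  constructor
  · intro h x hx
    obtain ⟨m, hm, rfl⟩ := Submodule.mem_map.1 hx
    have h1 : ((Matrix.toLin' (δ - 1)).restrictScalars 𝒪[K]) m ∈ scaleLattice c M := h (Submodule.mem_map.2 ⟨m, hm, rfl⟩)
    rw [mem_scaleLattice_iff hc] at h1
    simpa only [LinearMap.restrictScalars_apply, Matrix.toLin'_apply, Matrix.smul_mulVec] using h1
  · intro h x hx
    obtain ⟨m, hm, rfl⟩ := Submodule.mem_map.1 hx
    have h1 : ((Matrix.toLin' (c⁻¹ • (δ - 1))).restrictScalars 𝒪[K]) m ∈ M := h (Submodule.mem_map.2 ⟨m, hm, rfl⟩)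
    rw [mem_scaleLattice_iff hc]
    simpa only [LinearMap.restrictScalars_apply, Matrix.toLin'_apply, Matrix.smul_mulVec] using h1

/-- **SHIFT-STABLE ⇒ STABLE**: if `|c| ≤ 1`, `c ≠ 0` and `(c⁻¹ • (δ − 1))·M ⊆ M` then `δ·M ⊆ M` — because `δ = 1 + c·η ∈ 𝒪[η]` (★ `map_toLin'_le_of_mem_adjoin`). [cite: Kottwitz1986, §3] -/
theorem map_toLin'_le_of_map_shift_le {c : K} (hc : c ≠ 0) (hc1 : Valued.v c ≤ 1) (δ : Matrix (Fin N) (Fin N) K) (M : Submodule 𝒪[K] (Fin N → K))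
    (h : M.map ((Matrix.toLin' (c⁻¹ • (δ - 1))).restrictScalars 𝒪[K]) ≤ M) : M.map ((Matrix.toLin' δ).restrictScalars 𝒪[K]) ≤ M := by
  have hη : M.map ((Matrix.toLin' (c • (c⁻¹ • (δ - 1)))).restrictScalars 𝒪[K]) ≤ M := by
    intro x hx
    obtain ⟨m, hm, rfl⟩ := Submodule.mem_map.1 hx
    have h1 : ((Matrix.toLin' (c⁻¹ • (δ - 1))).restrictScalars 𝒪[K]) m ∈ M := h (Submodule.mem_map.2 ⟨m, hm, rfl⟩)
    have h2 := M.smul_mem (⟨c, (Valuation.mem_integer_iff _ _).2 hc1⟩ : 𝒪[K]) h1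
    rw [Subring.smul_def] at h2
    simpa only [LinearMap.restrictScalars_apply, Matrix.toLin'_apply, Matrix.smul_mulVec] using h2
  have hδ : (1 : Matrix (Fin N) (Fin N) K) + c • (c⁻¹ • (δ - 1)) = δ := by
    rw [smul_smul, mul_inv_cancel₀ hc, one_smul, add_sub_cancel]
  have h3 := (map_one_add_le_iff (c • (c⁻¹ • (δ - 1))) M).2 hη
  rwa [hδ] at h3

/-- **ROW 0 AS SHIFT-STABILITY, ONE LATTICE**: for `|c| ≤ 1`, `c ≠ 0`: `(δ·M ⊆ M ∧ (δ − 1)·M ⊆ c·M) ↔ (c⁻¹ • (δ − 1))·M ⊆ M`. [cite: Kottwitz1986, §3] [cite: Rogawski1990, §4.9 p. 55] -/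
theorem map_le_and_level_iff_map_shift_le {c : K} (hc : c ≠ 0) (hc1 : Valued.v c ≤ 1) (δ : Matrix (Fin N) (Fin N) K) (M : Submodule 𝒪[K] (Fin N → K)) :
    (M.map ((Matrix.toLin' δ).restrictScalars 𝒪[K]) ≤ M ∧ M.map ((Matrix.toLin' (δ - 1)).restrictScalars 𝒪[K]) ≤ scaleLattice c M) ↔
      M.map ((Matrix.toLin' (c⁻¹ • (δ - 1))).restrictScalars 𝒪[K]) ≤ M := by
  refine ⟨fun h => (map_sub_one_le_scaleLattice_iff_map_shift_le hc δ M).1 h.2, fun h => ⟨map_toLin'_le_of_map_shift_le hc hc1 δ M h, ?_⟩⟩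
  exact (map_sub_one_le_scaleLattice_iff_map_shift_le hc δ M).2 h

/-- **(E-0′a), SET FORM WITH A RIDING PREDICATE**: `{M | P M ∧ δ·M ⊆ M ∧ (δ−1)·M ⊆ c·M} = {M | P M ∧ (c⁻¹(δ−1))·M ⊆ M}` (`0 < |c| ≤ 1`). [cite: Kottwitz1986, §3] [cite: Rogawski1990, §4.9 p. 55] -/
theorem setOf_map_le_and_level_eq_setOf_map_shift_le (P : Submodule 𝒪[K] (Fin N → K) → Prop) {c : K} (hc : c ≠ 0) (hc1 : Valued.v c ≤ 1)
    (δ : Matrix (Fin N) (Fin N) K) :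
    {M : Submodule 𝒪[K] (Fin N → K) | P M ∧ M.map ((Matrix.toLin' δ).restrictScalars 𝒪[K]) ≤ M ∧
        M.map ((Matrix.toLin' (δ - 1)).restrictScalars 𝒪[K]) ≤ scaleLattice c M} =
      {M : Submodule 𝒪[K] (Fin N → K) | P M ∧ M.map ((Matrix.toLin' (c⁻¹ • (δ - 1))).restrictScalars 𝒪[K]) ≤ M} := by
  ext M
  simp only [Set.mem_setOf_eq]
  exact and_congr_right fun _ => map_le_and_level_iff_map_shift_le hc hc1 δ M

/-- **(E-0′a) ON THE VERTICES OF TYPE `d`, COUNT FORM** (`c = ϖ`, `d = 0`: «self-dual, `δ`-stable, residually trivial» = «self-dual, `ϖ⁻¹(δ−1)`-stable»; the `GL`∕FIXED reading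
`δ·M = M` is ★ law C1 `ncard_levelFixed_vertex_eq` + ★ `map_one_add_le_iff`). [cite: Jacobowitz1962, §7] [cite: Rogawski1990, §4.9 p. 55] -/
theorem ncard_vertex_map_le_and_level_eq (σ : K →+* K) (ϖ : K) (H : Matrix (Fin N) (Fin N) K) (d : ℕ) {c : K} (hc : c ≠ 0) (hc1 : Valued.v c ≤ 1)
    (δ : Matrix (Fin N) (Fin N) K) :
    {M : Submodule 𝒪[K] (Fin N → K) | IsVertexLattice σ ϖ H d M ∧ M.map ((Matrix.toLin' δ).restrictScalars 𝒪[K]) ≤ M ∧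
        M.map ((Matrix.toLin' (δ - 1)).restrictScalars 𝒪[K]) ≤ scaleLattice c M}.ncard =
      {M : Submodule 𝒪[K] (Fin N → K) | IsVertexLattice σ ϖ H d M ∧ M.map ((Matrix.toLin' (c⁻¹ • (δ - 1))).restrictScalars 𝒪[K]) ≤ M}.ncard := by
  rw [setOf_map_le_and_level_eq_setOf_map_shift_le _ hc hc1 δ]

/-- **FIXED versus STABLE row 0 on the vertices of type `d`** (`γ ∈ GL_N(K)`, `0 < |c| < 1`): the ★ law-C1 set `{γ·M = M ∧ (γ−1)·M ⊆ c·M}` and the stable set `{γ·M ⊆ M ∧ (γ−1)·M ⊆ c·M}`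
coincide (both equal the `c⁻¹(γ−1)`-stable vertices; directly: `γ·M + c·M = M` with `M = latt g` finitely generated and `|c| < 1` gives `γ·M = M` by Nakayama — here read off
★ law C1, whose §2 proves it by `g⁻¹γg ≡ 1 (mod c) ⇒ g⁻¹γg ∈ GL_N(𝒪)`). [cite: Kottwitz1986, §3] [cite: Serre1980Trees, Ch. II §1.1] -/
theorem setOf_vertex_mapGL_eq_and_level_eq_setOf_map_le_and_level (σ : K →+* K) (ϖ : K) (H : Matrix (Fin N) (Fin N) K) (d : ℕ) {c : K} (hc : c ≠ 0)
    (hc1 : Valued.v c < 1) (γ : GL (Fin N) K) :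
    {M : Submodule 𝒪[K] (Fin N → K) | IsVertexLattice σ ϖ H d M ∧ mapGL γ M = M ∧
        M.map ((Matrix.toLin' ((γ : Matrix (Fin N) (Fin N) K) - 1)).restrictScalars 𝒪[K]) ≤ scaleLattice c M} =
      {M : Submodule 𝒪[K] (Fin N → K) | IsVertexLattice σ ϖ H d M ∧ M.map ((Matrix.toLin' (γ : Matrix (Fin N) (Fin N) K)).restrictScalars 𝒪[K]) ≤ M ∧
        M.map ((Matrix.toLin' ((γ : Matrix (Fin N) (Fin N) K) - 1)).restrictScalars 𝒪[K]) ≤ scaleLattice c M} := by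
  rw [setOf_levelFixed_vertex_eq_setOf_levelShift_stable σ ϖ H d hc hc1 γ, setOf_map_le_and_level_eq_setOf_map_shift_le _ hc hc1.le]
  ext M
  simp only [Set.mem_setOf_eq, map_one_add_le_iff]

/-! ## §3 (E-0′b) THE SHIFT OF EISENSTEIN DATA `(Θ, a, b)` — pure algebra over `K` in any block-diagonal frame `φ : M₂(K) × K →ₐ[K] M_N(K)` -/

omit [Valued K ℤᵐ⁰] in
/-- The shifted element in the frame: `c⁻¹ • (φ(g, u) − 1) = φ(c⁻¹ • (g − 1), c⁻¹(u − 1))` for a unital `K`-algebra map `φ`. [cite: Rogawski1990, §4.9 p. 55] -/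
theorem smul_map_sub_one_eq_map_shift (φ : (Matrix (Fin 2) (Fin 2) K × K) →ₐ[K] Matrix (Fin N) (Fin N) K) (c : K) (g : Matrix (Fin 2) (Fin 2) K) (u : K) :
    c⁻¹ • (φ (g, u) - 1) = φ (c⁻¹ • (g - 1), c⁻¹ * (u - 1)) := by
  have h : ((c⁻¹ • (g - 1), c⁻¹ * (u - 1)) : Matrix (Fin 2) (Fin 2) K × K) = c⁻¹ • ((g, u) - 1) :=
    Prod.ext (by simp) (by simp [smul_eq_mul])
  rw [h, map_smul, map_sub, map_one]

omit [Valued K ℤᵐ⁰] in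
/-- The Eisenstein generator in the shifted variable: `Θ = α•1 + β•g ⇒ Θ = (α + β)•1 + (β c)•(c⁻¹ • (g − 1))` (`c ≠ 0`). [cite: Jacobowitz1962, §4] -/
theorem theta_eq_smul_one_add_smul_shift {c : K} (hc : c ≠ 0) {g Θ : Matrix (Fin 2) (Fin 2) K} {α β : K} (hΘ : Θ = α • 1 + β • g) :
    Θ = (α + β) • 1 + (β * c) • (c⁻¹ • (g - 1)) := by
  rw [hΘ, smul_smul, mul_assoc, mul_inv_cancel₀ hc, mul_one, smul_sub, add_smul]
  abel

omit [Valued K ℤᵐ⁰] in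
/-- The characteristic relation in the shifted variables: `u•1 − g = a•1 + b•Θ ⇒ (c⁻¹(u − 1))•1 − c⁻¹ • (g − 1) = (c⁻¹a)•1 + (c⁻¹b)•Θ`. [cite: Jacobowitz1962, §4] -/
theorem shift_smul_one_sub_shift_eq {c : K} {g Θ : Matrix (Fin 2) (Fin 2) K} {u a b : K} (h : u • 1 - g = a • 1 + b • Θ) :
    (c⁻¹ * (u - 1)) • (1 : Matrix (Fin 2) (Fin 2) K) - c⁻¹ • (g - 1) = (c⁻¹ * a) • 1 + (c⁻¹ * b) • Θ := by
  calc (c⁻¹ * (u - 1)) • (1 : Matrix (Fin 2) (Fin 2) K) - c⁻¹ • (g - 1) = c⁻¹ • (u • 1 - g) := by module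
    _ = (c⁻¹ * a) • 1 + (c⁻¹ * b) • Θ := by rw [h]; module

omit [Valued K ℤᵐ⁰] in
/-- `(c⁻¹(u − 1))•1 − c⁻¹ • (g − 1) = c⁻¹ • (u•1 − g)`, hence its determinant is `c⁻² · det(u•1 − g)` (`2 × 2`). [cite: Jacobowitz1962, §4] -/
theorem det_shift_smul_one_sub_shift (c : K) (g : Matrix (Fin 2) (Fin 2) K) (u : K) :
    ((c⁻¹ * (u - 1)) • (1 : Matrix (Fin 2) (Fin 2) K) - c⁻¹ • (g - 1)).det = c⁻¹ ^ 2 * (u • 1 - g).det := by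
  have e : (c⁻¹ * (u - 1)) • (1 : Matrix (Fin 2) (Fin 2) K) - c⁻¹ • (g - 1) = c⁻¹ • (u • 1 - g) := by module
  rw [e, Matrix.det_smul, Fintype.card_fin]

/-- Valuation bookkeeping of the shift: `v(x) = v(ϖ)^n`, `2 ≤ n` ⇒ `v(ϖ⁻¹ ^ 2 · x) = v(ϖ)^(n − 2)`; `v(b) = v(ϖ)^N`, `1 ≤ N` ⇒ `v(ϖ⁻¹ b) = v(ϖ)^(N − 1)` (`ϖ ≠ 0`).
[cite: Serre1980Trees, Ch. II §1.1] -/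
theorem v_inv_pow_two_mul_eq {ϖ x : K} (hϖ : ϖ ≠ 0) {n : ℕ} (hn : 2 ≤ n) (hx : Valued.v x = Valued.v ϖ ^ n) :
    Valued.v (ϖ⁻¹ ^ 2 * x) = Valued.v ϖ ^ (n - 2) := by
  have hϖ' : Valued.v ϖ ≠ 0 := (Valuation.ne_zero_iff _).2 hϖ
  obtain ⟨k, rfl⟩ := Nat.exists_eq_add_of_le hn
  rw [map_mul, map_pow, map_inv₀, hx, Nat.add_sub_cancel_left, pow_add, ← mul_assoc, inv_pow, inv_mul_cancel₀ (pow_ne_zero 2 hϖ'), one_mul]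

/-- See `v_inv_pow_two_mul_eq`. [cite: Serre1980Trees, Ch. II §1.1] -/
theorem v_inv_mul_eq {ϖ b : K} (hϖ : ϖ ≠ 0) {M₀ : ℕ} (hM : 1 ≤ M₀) (hb : Valued.v b = Valued.v ϖ ^ M₀) :
    Valued.v (ϖ⁻¹ * b) = Valued.v ϖ ^ (M₀ - 1) := by
  have hϖ' : Valued.v ϖ ≠ 0 := (Valuation.ne_zero_iff _).2 hϖ
  obtain ⟨k, rfl⟩ := Nat.exists_eq_add_of_le hM
  rw [map_mul, map_inv₀, hb, Nat.add_sub_cancel_left, pow_add, pow_one, ← mul_assoc, inv_mul_cancel₀ hϖ', one_mul]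

/-! ## §4 ROW 0 OF AN ABSTRACT TOTAL COUNT `F` — the hK₀ law `n₀(n, N) = TOT(n − 2, N − 1)` conditional only on the SHAPE of TOT-Λ -/

/-- **ROW 0 = TOTAL AT THE SHIFTED INVARIANTS, FOR AN ABSTRACT COUNT FUNCTION.**  Frame: a unital `K`-algebra map `φ : M₂(K) × K → M_N(K)` (any block-diagonal embedding in any
basis) and an arbitrary side condition `C` on the pair `(g, u)` (integrality, class datum, frame adaptedness, … — whatever TOT-Λ will carry), assumed here ONLY AT THE SHIFTED
PAIR `(g′, u′) = (ϖ⁻¹•(g − 1), ϖ⁻¹(u − 1))` (`hCg'`; the caller knows the original pair is deep — the ★ head's `hg1`∕`hu1` — and discharges it; `C` need not be shift-invariant: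
`u ∈ 𝒪 ⇏ ϖ⁻¹(u−1) ∈ 𝒪`).  HYPOTHESIS «TOT-Λ-shape for `F`»: for all data `(g, u, Θ, α, β, a, b)` with `C g u`,
`Θ = α•1 + β•g`, `v(det Θ) = v(ϖ)`, `v(tr Θ) < 1`, `u•1 − g = a•1 + b•Θ`, `v(det(u•1 − g)) = v(ϖ)^n′`, `v(b) = v(ϖ)^N′`, the `φ(g,u)`-stable vertices of type `d` number
`F n′ N′`.  CONCLUSION: for such data at `(n, N)` with `2 ≤ n`, `1 ≤ N`, the vertices of type `d` that are `φ(g,u)`-stable AND residually trivial (`(φ(g,u) − 1)·M ⊆ ϖ·M` — the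
rank-0 stratum ∕ row 0) number `F (n − 2) (N − 1)` — by §2 they are the `η`-stable vertices, `η = ϖ⁻¹(φ(g,u) − 1) = φ(g′, u′)`, whose Eisenstein data §3 have invariants
`(n − 2, N − 1)`.  (In the binder list nothing names `β ≠ 0`, but `v(det Θ) = v(ϖ)` forces it: `det(α•1) = α²` has even valuation.)  No `2`, no `d`-exponent, no unitarity
of `g`. [cite: Rogawski1990, §4.9 p. 55] [cite: Kottwitz1986, §3] [cite: Jacobowitz1962, §7] -/
theorem ncard_vertex_rowZero_eq_of_total (σ : K →+* K) {ϖ : K} (hϖ0 : ϖ ≠ 0) (hϖ1 : Valued.v ϖ ≤ 1) (H : Matrix (Fin N) (Fin N) K) (d : ℕ)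
    (φ : (Matrix (Fin 2) (Fin 2) K × K) →ₐ[K] Matrix (Fin N) (Fin N) K) (C : Matrix (Fin 2) (Fin 2) K → K → Prop) (F : ℕ → ℕ → ℕ)
    (hT : ∀ (g Θ : Matrix (Fin 2) (Fin 2) K) (u α β a b : K) (n' N' : ℕ), C g u → Θ = α • 1 + β • g → Valued.v Θ.det = Valued.v ϖ → Valued.v Θ.trace < 1 →
      u • 1 - g = a • 1 + b • Θ → Valued.v (u • 1 - g).det = Valued.v ϖ ^ n' → Valued.v b = Valued.v ϖ ^ N' →
      {M : Submodule 𝒪[K] (Fin N → K) | IsVertexLattice σ ϖ H d M ∧ M.map ((Matrix.toLin' (φ (g, u))).restrictScalars 𝒪[K]) ≤ M}.ncard = F n' N')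
    {g Θ : Matrix (Fin 2) (Fin 2) K} {u α β a b : K} {n M₀ : ℕ} (hCg' : C (ϖ⁻¹ • (g - 1)) (ϖ⁻¹ * (u - 1))) (hΘ : Θ = α • 1 + β • g) (hΘd : Valued.v Θ.det = Valued.v ϖ)
    (hΘt : Valued.v Θ.trace < 1) (hrel : u • 1 - g = a • 1 + b • Θ) (hn : Valued.v (u • 1 - g).det = Valued.v ϖ ^ n) (hb : Valued.v b = Valued.v ϖ ^ M₀)
    (hn2 : 2 ≤ n) (hN1 : 1 ≤ M₀) :
    {M : Submodule 𝒪[K] (Fin N → K) | IsVertexLattice σ ϖ H d M ∧ M.map ((Matrix.toLin' (φ (g, u))).restrictScalars 𝒪[K]) ≤ M ∧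
        M.map ((Matrix.toLin' (φ (g, u) - 1)).restrictScalars 𝒪[K]) ≤ scaleLattice ϖ M}.ncard = F (n - 2) (M₀ - 1) := by
  -- §2: the row-0 (residually trivial, stable) vertices are the `η`-stable vertices, `η = ϖ⁻¹ • (φ(g,u) − 1) = φ(g′, u′)` (§3)
  rw [ncard_vertex_map_le_and_level_eq σ ϖ H d hϖ0 hϖ1 (φ (g, u)), smul_map_sub_one_eq_map_shift φ ϖ g u]
  -- §3: the Eisenstein data of `(g′, u′)` — same `Θ`, invariants `(n − 2, N − 1)` — fed to the TOT-Λ-shaped hypothesis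
  exact hT (ϖ⁻¹ • (g - 1)) Θ (ϖ⁻¹ * (u - 1)) (α + β) (β * ϖ) (ϖ⁻¹ * a) (ϖ⁻¹ * b) (n - 2) (M₀ - 1) hCg'
    (theta_eq_smul_one_add_smul_shift hϖ0 hΘ) hΘd hΘt (shift_smul_one_sub_shift_eq hrel)
    (by rw [det_shift_smul_one_sub_shift, v_inv_pow_two_mul_eq hϖ0 hn2 hn]) (v_inv_mul_eq hϖ0 hN1 hb)

/-- **ROW 0 = TOTAL AT THE SHIFTED INVARIANTS — variant with a GLOBALLY shift-invariant side condition** `C` (`hC`), assumed at the original pair (`hCg`); corollary of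
`ncard_vertex_rowZero_eq_of_total`. [cite: Rogawski1990, §4.9 p. 55] [cite: Kottwitz1986, §3] -/
theorem ncard_vertex_rowZero_eq_of_total_of_shiftInvariant (σ : K →+* K) {ϖ : K} (hϖ0 : ϖ ≠ 0) (hϖ1 : Valued.v ϖ ≤ 1) (H : Matrix (Fin N) (Fin N) K) (d : ℕ)
    (φ : (Matrix (Fin 2) (Fin 2) K × K) →ₐ[K] Matrix (Fin N) (Fin N) K) (C : Matrix (Fin 2) (Fin 2) K → K → Prop)
    (hC : ∀ (g : Matrix (Fin 2) (Fin 2) K) (u : K), C g u → C (ϖ⁻¹ • (g - 1)) (ϖ⁻¹ * (u - 1))) (F : ℕ → ℕ → ℕ)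
    (hT : ∀ (g Θ : Matrix (Fin 2) (Fin 2) K) (u α β a b : K) (n' N' : ℕ), C g u → Θ = α • 1 + β • g → Valued.v Θ.det = Valued.v ϖ → Valued.v Θ.trace < 1 →
      u • 1 - g = a • 1 + b • Θ → Valued.v (u • 1 - g).det = Valued.v ϖ ^ n' → Valued.v b = Valued.v ϖ ^ N' →
      {M : Submodule 𝒪[K] (Fin N → K) | IsVertexLattice σ ϖ H d M ∧ M.map ((Matrix.toLin' (φ (g, u))).restrictScalars 𝒪[K]) ≤ M}.ncard = F n' N')
    {g Θ : Matrix (Fin 2) (Fin 2) K} {u α β a b : K} {n M₀ : ℕ} (hCg : C g u) (hΘ : Θ = α • 1 + β • g) (hΘd : Valued.v Θ.det = Valued.v ϖ)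
    (hΘt : Valued.v Θ.trace < 1) (hrel : u • 1 - g = a • 1 + b • Θ) (hn : Valued.v (u • 1 - g).det = Valued.v ϖ ^ n) (hb : Valued.v b = Valued.v ϖ ^ M₀)
    (hn2 : 2 ≤ n) (hN1 : 1 ≤ M₀) :
    {M : Submodule 𝒪[K] (Fin N → K) | IsVertexLattice σ ϖ H d M ∧ M.map ((Matrix.toLin' (φ (g, u))).restrictScalars 𝒪[K]) ≤ M ∧
        M.map ((Matrix.toLin' (φ (g, u) - 1)).restrictScalars 𝒪[K]) ≤ scaleLattice ϖ M}.ncard = F (n - 2) (M₀ - 1) :=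
  ncard_vertex_rowZero_eq_of_total σ hϖ0 hϖ1 H d φ C F hT (hC g u hCg) hΘ hΘd hΘt hrel hn hb hn2 hN1

end Literature.NumberTheory.Automorphic.UnitaryLatticeTree

end
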